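import Mathlib
import HarnessLib

/-!
# The determinant of a complex-linear operator preserving a real form equals the real determinant on the form
# (Arnold, *Ordinary Differential Equations*, §18: `(ℂA) = (A)`, `det ℂA = det A`)

Topic `Literature/LinearAlgebra`; namespace `Literature.LinearAlgebra.RealForm`.  Theorems only (no definitions, no named
facts, no `sorry`).

SETTING.  `W` a finite-dimensional complex vector space (an `ℝ`-space by restriction of scalars, Mathlib's
`Module.complexToReal`), `U ≤ W` a complex subspace and `V ≤ W` a REAL subspace which is a REAL FORM of `U`:
`V ⊆ U` (`hVU`), `U = V + iV` (`hspan : ∀ u ∈ U, ∃ v w ∈ V, u = v + I•w`) and `V ∩ iV = 0` in the strong form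
`v + I•w = 0 ⇒ v = w = 0` (`hindep`) — i.e. `U` is the complexification `ℂ ⊗_ℝ V` realised inside `W` (Arnold §18.2–18.3: the
«real plane» of `ᶜℝⁿ`; equivalently `V = Fix σ` for a conjugation `σ` of `U`).  A complex-linear `T : W → W` preserving `U` and `V`
is then, on `U`, the complexification of the real operator `T|_V` (Arnold §18.3 Problem 5: `Ā = A`).

RESULTS.
* `linearIndependent_coe_basis` — an `ℝ`-basis of `V` is `ℂ`-linearly independent in `W` (given `hindep`);
  `mem_span_coe_basis` — every `u = v + I•w`, `v, w ∈ V`, is in its `ℂ`-span (Arnold §18.2: «if `(e_1,…,e_n)` is a basis in `ℝⁿ`,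
  then the vectors `e_k = e_k + i0` form a `ℂ`-basis in `ᶜℝⁿ`»).
* ★ `toMatrix_restrict_eq_map` — in such a pair of bases the matrix of `T|_U` over `ℂ` IS the matrix of `T|_V` over `ℝ`
  (entrywise `algebraMap ℝ ℂ`): Arnold §18.2 Problem 1 «`(ᶜA) = (A)`».
* ★★ `det_restrict_eq_ofReal_det_restrict` — `det_ℂ (T|_U) = det_ℝ (T|_V)` (Arnold §18.4 Problem 2 «`det ᶜA = det A`»), and the
  whole-space form ★★ `det_eq_ofReal_det_restrict` (`U = W`); `trace_restrict_eq_ofReal_trace_restrict` (§18.4 Problem 3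
  «`tr ᶜA = tr A`»).
* the two standard real forms of a complex `⋆`-module (`StarModule ℂ W`): `exists_selfAdjoint_add_I_smul` ∕
  `eq_zero_of_selfAdjoint_add_I_smul_eq_zero` (`W = H ⊕ iH`, `H` the self-adjoint part) and `exists_skewAdjoint_add_I_smul` ∕
  `eq_zero_of_skewAdjoint_add_I_smul_eq_zero` (`W = K ⊕ iK`, `K` the skew-adjoint part — `M_N(ℂ) = 𝔲(N) ⊕ i𝔲(N)`), i.e. the
  hypotheses `hspan`∕`hindep` discharged at the `⋆` level.

WHY (cell `ym-ir`, row 43, K31).  The Gaussian constant of the twisted slab is `det_ℝ` of the real covariant Laplacian `Δ` on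
`𝔰𝔲(N)`-valued site fields `V = suFields`; its colour-momentum diagonalisation lives on the complex traceless fields
`U = tracelessFields = V ⊕ iV` (`X = (X − Xᴴ)/2 + i·(X + Xᴴ)/(2i)`), where `Δ` is complex-linear and block-diagonal in 't Hooft's
basis `Γ_p ⊗ δ_x`.  This file is the one-line bridge `det_ℝ Δ|_V = det_ℂ Δ|_U`; the blocks are `TwistedCycleLaplacian.lean`'s.

HONEST SCOPE: elementary linear algebra; nothing here bears on the Yang–Mills mass gap (Clay: NOT proved); `R4` closes only
the conditional finite-`𝕋⁴` rung `BalabanLadder.UV`.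

## References
* V. I. Arnold, *Ordinary Differential Equations* (Universitext, Springer 2006, transl. R. Cooke), §18 «Complexification and
  Realification»: §18.2 (complexification of a space and of an operator; Problem 1 `(ᶜA) = (A)`), §18.3 (the real plane, the
  conjugation `σ`; Problem 5: `A` is a complexification iff `Ā = A`), §18.4 Problem 2 (`det ᶜA = det A`), Problem 3
  (`tr ᶜA = tr A`) (corpus `book:arnold2006-ordinary-differential-equations` p0154–p0156). [Arnold2006ODE]
-/

noncomputable section

open Complex Module

namespace Literature.LinearAlgebra.RealForm

variable {W : Type*} [AddCommGroup W] [Module ℂ W]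
variable {ι : Type*} [Fintype ι]

/-- The `ℝ`-action on a complex space is the restricted one: `r • x = (r : ℂ) • x`. [cite: Arnold2006ODE, §18.1 (realification)] -/
theorem real_smul_eq_coe_smul (r : ℝ) (x : W) : r • x = (r : ℂ) • x := (Complex.coe_smul r x).symm

/-- Splitting a complex combination of real vectors into real and imaginary parts:
`Σ g_j • x_j = Σ (re g_j) • x_j + I • Σ (im g_j) • x_j`. [cite: Arnold2006ODE, §18.2 (`ξ + iη`)] -/
theorem sum_smul_eq_re_add_I_smul_im (g : ι → ℂ) (x : ι → W) :
    ∑ j, g j • x j = (∑ j, (g j).re • x j) + I • ∑ j, (g j).im • x j := by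
  rw [Finset.smul_sum, ← Finset.sum_add_distrib]
  refine Finset.sum_congr rfl fun j _ => ?_
  rw [real_smul_eq_coe_smul, real_smul_eq_coe_smul, smul_smul, ← add_smul]
  congr 1
  rw [mul_comm]
  exact (Complex.re_add_im (g j)).symm

/-- ★ **An `ℝ`-basis of a real form is `ℂ`-linearly independent** (as vectors of the ambient complex space), provided
`v + I•w = 0 ⇒ v = w = 0` on `V`. [cite: Arnold2006ODE, §18.2 («the vectors `e_k` form a `ℂ`-basis in `ᶜℝⁿ`»)] -/
theorem linearIndependent_coe_basis {V : Submodule ℝ W} (b : Basis ι ℝ V)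
    (hindep : ∀ v ∈ V, ∀ w ∈ V, v + I • w = 0 → v = 0 ∧ w = 0) :
    LinearIndependent ℂ (fun i => ((b i : V) : W)) := by
  rw [Fintype.linearIndependent_iff]
  intro g hg i
  rw [sum_smul_eq_re_add_I_smul_im] at hg
  have hv : (∑ j, (g j).re • ((b j : V) : W)) ∈ V :=
    V.sum_mem fun j _ => V.smul_mem _ (b j).2
  have hw : (∑ j, (g j).im • ((b j : V) : W)) ∈ V :=
    V.sum_mem fun j _ => V.smul_mem _ (b j).2
  obtain ⟨h1, h2⟩ := hindep _ hv _ hw hg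
  have hb := Fintype.linearIndependent_iff.1 b.linearIndependent
  have h1' : ∑ j, (g j).re • b j = 0 := by
    apply Subtype.ext
    rw [Submodule.coe_sum, Submodule.coe_zero]
    simpa only [Submodule.coe_smul] using h1
  have h2' : ∑ j, (g j).im • b j = 0 := by
    apply Subtype.ext
    rw [Submodule.coe_sum, Submodule.coe_zero]
    simpa only [Submodule.coe_smul] using h2
  exact Complex.ext (by simpa using hb _ h1' i) (by simpa using hb _ h2' i)

/-- ★ **… and spans every `v + I•w` with `v, w` in the real form.** [cite: Arnold2006ODE, §18.2 («`ᶜℝⁿ = ℂⁿ`»)] -/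
theorem mem_span_coe_basis {V : Submodule ℝ W} (b : Basis ι ℝ V) {u : W}
    (hu : ∃ v ∈ V, ∃ w ∈ V, u = v + I • w) :
    u ∈ Submodule.span ℂ (Set.range fun i => ((b i : V) : W)) := by
  have hmem : ∀ v ∈ V, v ∈ Submodule.span ℂ (Set.range fun i => ((b i : V) : W)) := by
    intro v hv
    have hsum : (((⟨v, hv⟩ : V) : W)) = ∑ i, (b.repr ⟨v, hv⟩ i) • ((b i : V) : W) := by
      conv_lhs => rw [← b.sum_repr ⟨v, hv⟩]
      rw [Submodule.coe_sum]
      simp only [Submodule.coe_smul]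
    change ((⟨v, hv⟩ : V) : W) ∈ _
    rw [hsum]
    refine Submodule.sum_mem _ fun i _ => ?_
    rw [real_smul_eq_coe_smul]
    exact Submodule.smul_mem _ _ (Submodule.subset_span ⟨i, rfl⟩)
  obtain ⟨v, hv, w, hw, rfl⟩ := hu
  exact Submodule.add_mem _ (hmem v hv) (Submodule.smul_mem _ _ (hmem w hw))

variable [DecidableEq ι]

/-- ★ **«`(ᶜA) = (A)`»**: if `c` is a `ℂ`-basis of `U` sitting on an `ℝ`-basis `b` of the real form `V` (`c i = b i` as vectors of
`W`), then for a complex-linear `T` preserving `U` and `V` the matrix of `T|_U` in `c` is the (real) matrix of `T|_V` in `b`.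
[cite: Arnold2006ODE, §18.2 Problem 1] -/
theorem toMatrix_restrict_eq_map (T : W →ₗ[ℂ] W) {U : Submodule ℂ W} {V : Submodule ℝ W}
    (hU : ∀ u ∈ U, T u ∈ U) (hV : ∀ v ∈ V, T v ∈ V) (b : Basis ι ℝ V) (c : Basis ι ℂ U)
    (hbc : ∀ i, (c i : W) = (b i : W)) :
    LinearMap.toMatrix c c (T.restrict hU) =
      (LinearMap.toMatrix b b ((T.restrictScalars ℝ).restrict hV)).map (algebraMap ℝ ℂ) := by
  ext i j
  rw [Matrix.map_apply, LinearMap.toMatrix_apply, LinearMap.toMatrix_apply]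
  -- expand `T (b j)` in the real basis
  set r : ι → ℝ := fun k => b.repr (((T.restrictScalars ℝ).restrict hV) (b j)) k with hr
  have hTV : (((T.restrictScalars ℝ).restrict hV) (b j) : W) = ∑ k, r k • ((b k : V) : W) := by
    conv_lhs => rw [← b.sum_repr (((T.restrictScalars ℝ).restrict hV) (b j))]
    rw [Submodule.coe_sum]
    simp only [Submodule.coe_smul, hr]
  have hTU : (T.restrict hU) (c j) = ∑ k, (r k : ℂ) • c k := by
    apply Subtype.ext
    rw [LinearMap.coe_restrict_apply, Submodule.coe_sum, hbc j]
    have : T (b j : W) = ∑ k, r k • ((b k : V) : W) := by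
      rw [← hTV]; rfl
    rw [this]
    refine Finset.sum_congr rfl fun k _ => ?_
    rw [Submodule.coe_smul, hbc k, real_smul_eq_coe_smul]
  rw [hTU, c.repr_sum_self]
  simp [hr]

variable [FiniteDimensional ℂ W]

/-- ★★ **`det_ℂ (T|_U) = det_ℝ (T|_V)` for a real form `V` of `U`** («`det ᶜA = det A`»): `T : W → W` complex-linear preserving the
complex subspace `U` and the real subspace `V`, with `V ⊆ U`, `U = V + I•V` and `v + I•w = 0 ⇒ v = w = 0` on `V`.
[cite: Arnold2006ODE, §18.4 Problem 2; §18.3 Problem 5] -/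
theorem det_restrict_eq_ofReal_det_restrict (T : W →ₗ[ℂ] W) {U : Submodule ℂ W} {V : Submodule ℝ W}
    (hU : ∀ u ∈ U, T u ∈ U) (hV : ∀ v ∈ V, T v ∈ V) (hVU : ∀ v ∈ V, v ∈ U)
    (hspan : ∀ u ∈ U, ∃ v ∈ V, ∃ w ∈ V, u = v + I • w)
    (hindep : ∀ v ∈ V, ∀ w ∈ V, v + I • w = 0 → v = 0 ∧ w = 0) :
    LinearMap.det (T.restrict hU) = ((LinearMap.det ((T.restrictScalars ℝ).restrict hV) : ℝ) : ℂ) := by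
  classical
  let b := Module.finBasis ℝ V
  let e : Fin (finrank ℝ V) → U := fun i => ⟨(b i : W), hVU _ (b i).2⟩
  have hli : LinearIndependent ℂ e := by
    refine LinearIndependent.of_comp U.subtype ?_
    exact linearIndependent_coe_basis b hindep
  have hsp : ⊤ ≤ Submodule.span ℂ (Set.range e) := by
    intro u _
    rw [← Submodule.apply_mem_span_image_iff_mem_span (Submodule.injective_subtype U), ← Set.range_comp]
    exact mem_span_coe_basis b (hspan u u.2)
  let c : Basis (Fin (finrank ℝ V)) ℂ U := Basis.mk hli hsp
  have hbc : ∀ i, (c i : W) = (b i : W) := fun i => by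
    simp only [c, Basis.mk_apply, e]
  rw [← LinearMap.det_toMatrix c, toMatrix_restrict_eq_map T hU hV b c hbc, ← RingHom.mapMatrix_apply, ← RingHom.map_det,
    LinearMap.det_toMatrix]
  rfl

/-- ★★ **Whole-space form**: if `V` is a real form of `W` itself (`W = V + I•V`, `v + I•w = 0 ⇒ v = w = 0`) and `T` preserves `V`,
then `det_ℂ T = det_ℝ (T|_V)`. [cite: Arnold2006ODE, §18.4 Problem 2] -/
theorem det_eq_ofReal_det_restrict (T : W →ₗ[ℂ] W) {V : Submodule ℝ W} (hV : ∀ v ∈ V, T v ∈ V)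
    (hspan : ∀ u : W, ∃ v ∈ V, ∃ w ∈ V, u = v + I • w)
    (hindep : ∀ v ∈ V, ∀ w ∈ V, v + I • w = 0 → v = 0 ∧ w = 0) :
    LinearMap.det T = ((LinearMap.det ((T.restrictScalars ℝ).restrict hV) : ℝ) : ℂ) := by
  have hU : ∀ u ∈ (⊤ : Submodule ℂ W), T u ∈ (⊤ : Submodule ℂ W) := fun _ _ => Submodule.mem_top
  have h := det_restrict_eq_ofReal_det_restrict T hU hV (fun _ _ => Submodule.mem_top) (fun u _ => hspan u) hindep
  rw [← h]
  have hconj : T.restrict hU =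
      ((Submodule.topEquiv (R := ℂ) (M := W)).symm : W →ₗ[ℂ] (⊤ : Submodule ℂ W)) ∘ₗ T ∘ₗ
        ((Submodule.topEquiv (R := ℂ) (M := W)).symm.symm : (⊤ : Submodule ℂ W) →ₗ[ℂ] W) := by
    apply LinearMap.ext
    intro u
    apply Subtype.ext
    rfl
  rw [hconj, LinearMap.det_conj]

/-- «`tr ᶜA = tr A`»: the same for traces. [cite: Arnold2006ODE, §18.4 Problem 3] -/
theorem trace_restrict_eq_ofReal_trace_restrict (T : W →ₗ[ℂ] W) {U : Submodule ℂ W} {V : Submodule ℝ W}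
    (hU : ∀ u ∈ U, T u ∈ U) (hV : ∀ v ∈ V, T v ∈ V) (hVU : ∀ v ∈ V, v ∈ U)
    (hspan : ∀ u ∈ U, ∃ v ∈ V, ∃ w ∈ V, u = v + I • w)
    (hindep : ∀ v ∈ V, ∀ w ∈ V, v + I • w = 0 → v = 0 ∧ w = 0) :
    LinearMap.trace ℂ U (T.restrict hU) = ((LinearMap.trace ℝ V ((T.restrictScalars ℝ).restrict hV) : ℝ) : ℂ) := by
  classical
  let b := Module.finBasis ℝ V
  let e : Fin (finrank ℝ V) → U := fun i => ⟨(b i : W), hVU _ (b i).2⟩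
  have hli : LinearIndependent ℂ e := by
    refine LinearIndependent.of_comp U.subtype ?_
    exact linearIndependent_coe_basis b hindep
  have hsp : ⊤ ≤ Submodule.span ℂ (Set.range e) := by
    intro u _
    rw [← Submodule.apply_mem_span_image_iff_mem_span (Submodule.injective_subtype U), ← Set.range_comp]
    exact mem_span_coe_basis b (hspan u u.2)
  let c : Basis (Fin (finrank ℝ V)) ℂ U := Basis.mk hli hsp
  have hbc : ∀ i, (c i : W) = (b i : W) := fun i => by
    simp only [c, Basis.mk_apply, e]
  rw [LinearMap.trace_eq_matrix_trace ℂ c, LinearMap.trace_eq_matrix_trace ℝ b, toMatrix_restrict_eq_map T hU hV b c hbc,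
    ← AddMonoidHom.map_trace (algebraMap ℝ ℂ)]
  rfl

/-! ## The standard real forms of a complex `⋆`-module: self-adjoint and skew-adjoint parts -/

section Star

omit [Fintype ι] [DecidableEq ι] [FiniteDimensional ℂ W]
variable [StarAddMonoid W] [StarModule ℂ W]

/-- `W = H + I•H` for the self-adjoint part `H = {x | x⋆ = x}`: `u = (u + u⋆)/2 + I•(−(I/2)•(u − u⋆))`.
[cite: Arnold2006ODE, §18.3 (real and imaginary planes, `σ(ξ + iη) = ξ − iη`)] -/
theorem exists_selfAdjoint_add_I_smul (u : W) :
    ∃ v : W, star v = v ∧ ∃ w : W, star w = w ∧ u = v + I • w := by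
  refine ⟨(2⁻¹ : ℂ) • (u + star u), ?_, (-(I / 2)) • (u - star u), ?_, ?_⟩
  · rw [star_smul, star_add, star_star, add_comm]
    norm_num
  · rw [star_smul, star_sub, star_star]
    have h : star (-(I / 2)) = I / 2 := by
      rw [star_neg, star_div₀, Complex.star_def, Complex.conj_I, map_ofNat]
      ring
    rw [h, ← neg_sub u (star u), smul_neg, ← neg_smul]
  · rw [smul_smul, smul_add, smul_sub]
    have h : I * -(I / 2) = 2⁻¹ := by
      rw [mul_neg, mul_div_assoc', Complex.I_mul_I]
      norm_num
    rw [h]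
    module

/-- `H ∩ I•H = 0` in the strong form: `v⋆ = v`, `w⋆ = w`, `v + I•w = 0 ⇒ v = w = 0`.
[cite: Arnold2006ODE, §18.3 («the whole space is the direct sum of these two subspaces»)] -/
theorem eq_zero_of_selfAdjoint_add_I_smul_eq_zero {v w : W} (hv : star v = v) (hw : star w = w) (h : v + I • w = 0) :
    v = 0 ∧ w = 0 := by
  have h' : v - I • w = 0 := by
    have := congrArg star h
    rwa [star_add, star_smul, hv, hw, star_zero, Complex.star_def, Complex.conj_I, neg_smul, ← sub_eq_add_neg] at this
  have hv0 : v = 0 := by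
    have h2 : (2 : ℂ) • v = 0 := by
      rw [two_smul]
      calc v + v = (v + I • w) + (v - I • w) := by abel
        _ = 0 := by rw [h, h', add_zero]
    exact (smul_eq_zero.1 h2).resolve_left two_ne_zero
  refine ⟨hv0, ?_⟩
  rw [hv0, zero_add] at h
  exact (smul_eq_zero.1 h).resolve_left Complex.I_ne_zero

/-- `W = K + I•K` for the skew-adjoint part `K = {x | x⋆ = −x}` (e.g. `𝔲(N) ⊂ M_N(ℂ)`, `M_N(ℂ) = 𝔲(N) ⊕ i𝔲(N)`):
`u = (u − u⋆)/2 + I•(−(I/2)•(u + u⋆))`. [cite: Arnold2006ODE, §18.3] -/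
theorem exists_skewAdjoint_add_I_smul (u : W) :
    ∃ v : W, star v = -v ∧ ∃ w : W, star w = -w ∧ u = v + I • w := by
  refine ⟨(2⁻¹ : ℂ) • (u - star u), ?_, (-(I / 2)) • (u + star u), ?_, ?_⟩
  · rw [star_smul, star_sub, star_star, ← neg_sub u (star u), smul_neg]
    norm_num
  · rw [star_smul, star_add, star_star]
    have h : star (-(I / 2)) = I / 2 := by
      rw [star_neg, star_div₀, Complex.star_def, Complex.conj_I, map_ofNat]
      ring
    rw [h, add_comm (star u) u, ← neg_smul, neg_neg]
  · rw [smul_smul, smul_add, smul_sub]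
    have h : I * -(I / 2) = 2⁻¹ := by
      rw [mul_neg, mul_div_assoc', Complex.I_mul_I]
      norm_num
    rw [h]
    module

/-- `K ∩ I•K = 0`: `v⋆ = −v`, `w⋆ = −w`, `v + I•w = 0 ⇒ v = w = 0`. [cite: Arnold2006ODE, §18.3] -/
theorem eq_zero_of_skewAdjoint_add_I_smul_eq_zero {v w : W} (hv : star v = -v) (hw : star w = -w) (h : v + I • w = 0) :
    v = 0 ∧ w = 0 := by
  have h' : -v + I • w = 0 := by
    have := congrArg star h
    rwa [star_add, star_smul, hv, hw, star_zero, Complex.star_def, Complex.conj_I, smul_neg, neg_smul, neg_neg] at this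
  have hv0 : v = 0 := by
    have h2 : (2 : ℂ) • v = 0 := by
      rw [two_smul]
      calc v + v = (v + I • w) - (-v + I • w) := by abel
        _ = 0 := by rw [h, h', sub_zero]
    exact (smul_eq_zero.1 h2).resolve_left two_ne_zero
  refine ⟨hv0, ?_⟩
  rw [hv0, zero_add] at h
  exact (smul_eq_zero.1 h).resolve_left Complex.I_ne_zero

end Star

end Literature.LinearAlgebra.RealForm

end
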